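/-
Copyright: the b2b-balaban T⁴-continuum CRUX team, row NE7b OWNER lineage `t4-ne7b-p1` (gen 148). Project licence.
-/
import Summits.QuantumFields.BalabanUV.T4Continuum.Spine.NE7b.SupWeightedClassMapOrderTwoStep
import Summits.QuantumFields.BalabanUV.T4Continuum.Spine.NE7b.SupWeightedTorusInstance

/-!
# ONE FULL STEP OF THE WEIGHTED CLASS AT ORDER TWO ON THE ROAD'S TORI — THE GEOMETRY DISCHARGED (SCOPING-d20 §C (1); file (790)).
# (767) typed the order-2 step (fluctuation (748) ∘ weighted transport (766)) for an ABSTRACT block map `β` with fibre bound `n`, abstract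
# weights `ϑ` (output, fine) and `ϑc` (next input, coarse) with `ϑc(βx,βx′) ≤ M·ϑ(x,x′)`; (786) proved these three geometric data on the
# road's tori.  THIS FILE is the INSTANCE: fine torus `Site d ((n+1)s)`, coarse torus `Site d s`, the torus block map
# `x ↦ siteOf d s (blk n (windowMap d ((n+1)s) x))` (TDF), the `ℓ¹` circular distance of (132), weights `ϑ = e^{νρ_{(n+1)s}}`, `ϑc = e^{νc ρ_s}`:
# (767)'s conclusions hold with `n_blk = (n+1)^d`, `M = e^{νc·dn∕(n+1)}` and NO geometric hypothesis — only the analytic class data (the road's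
# regularised Gaussian `μ_{AAᵀ}`, stability, Hessian letters, the dressed propagator letters `D, θ, σ, σA`, the input weight `ϑ₂` with
# `e^{νρ} ≤ ϑ₂`) and the rates `0 ≤ νc ≤ (n+1)ν` remain (row NE7b, node U5c; (767), (786) BY NAME; [folklore]; generator `records/gen790.py`).
# The template for orders 3–5 ((769)/(776), (772)/(777)–(779), (773)/(780)–(783) with (786) the same way).

Cell `pub-balaban`, sub-cell `t4`, spine estimate NE7b (`T4WeightBudget.RelWeightBound`; the cell's OWN estimate — NOT PRINTED in
[Bałaban 1983–89], NOT PROVED).  Crux-route work under `Spine/NE7b/` by the row OWNER (`t4-ne7b-p1` gen 148, file (790)) under FREEZE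
(0)'s crux-prover clause; NOTHING of Bałaban's is named as a Lean object, valued or asserted; no `T4Continuum/Support` leaf typed; no
`def`, no notation (block map, distances, weights, `HessW⁺` WRITTEN OUT); zero `sorry`.  Imports (BY NAME): (767) `…SupWeightedClassMapOrderTwoStep`
(`classmap_two_step_row`, `classmap_two_step_col`), (786) `…SupWeightedTorusInstance` (`fibre_card_le`, `torus_block_factor`, `torus_weight_one_le`,
`torus_weight_symm`).

WHAT IS PROVED ([folklore]): **`classmap_two_step_row_torus`**, **`classmap_two_step_col_torus`**; toy.

HONEST (what this is NOT).  An instance: the analytic class data stay hypotheses; the rates' admissibility is (787); the flow of the letter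
VALUES is (784)/(788) (order 2 is RELEVANT: factor `t²(n+1)^d M = (n+1)²M` at `t = (n+1)⁻¹`, `d = 4` — extracted∕tuned, not iterated); scalar
skeleton ((A3), NC-NE7b-α UNRULED); nothing of Bałaban's asserted.  BY-NAME EFFECT ON THE WALL: NONE.  NE7b NOT PRINTED ∕ NOT PROVED; spine
PROVED 0∕9; rung (B)+1 — the programme's measures remain FINITE-torus statements; NOT the mass gap, NOT Clay.  HONEST DEPENDENCY: continuum YM
on T⁴ ⇐ BetaPertH ∧ nine spine estimates (0∕9 proved); BetaPertH ⇐ (D1) ∧ (D4) ∧ CAP+tail; G-an2-4 gates asym, D1 and NE2∕3∕4.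
-/

set_option autoImplicit false
set_option maxSynthPendingDepth 3

noncomputable section

namespace Summit.QuantumFields.BalabanUV.T4Continuum.NE7b.SupWeightedClassMapOrderTwoStepTorus

open MeasureTheory ProbabilityTheory Finset Real Matrix
open scoped BigOperators Matrix
open Literature.MathematicalPhysics.QuantumFieldTheory.Balaban1983to89
open B6QGQLower276 (blk)
open Beta (Site siteOf windowMap)
open SupWeightedClassMapOrderTwoStep (classmap_two_step_row classmap_two_step_col)
open SupWeightedTorusInstance (fibre_card_le torus_block_factor torus_weight_one_le torus_weight_symm)

variable {d : ℕ} {κ : Type} [Fintype κ] [DecidableEq κ]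
variable {n s : ℕ}
variable {U : EuclideanSpace ℝ (Site d ((n + 1) * s)) → ℝ} {U' : EuclideanSpace ℝ (Site d ((n + 1) * s)) → EuclideanSpace ℝ (Site d ((n + 1) * s)) →L[ℝ] ℝ}
  {U'' : EuclideanSpace ℝ (Site d ((n + 1) * s)) → EuclideanSpace ℝ (Site d ((n + 1) * s)) →L[ℝ] EuclideanSpace ℝ (Site d ((n + 1) * s)) →L[ℝ] ℝ}
      {Hk : (Site d ((n + 1) * s)) → (Site d ((n + 1) * s)) → ℝ} {A : Matrix (Site d ((n + 1) * s)) κ ℝ} {D : κ → κ → ℝ}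
  {γop κ₀ κ₁ κ₂ a τ δ θp lamA αr αc hr γ dθ dθ' αθ αθc αrσ αcσ hrϑ hcϑ : ℝ} {θ : κ → κ → ℝ} {σ σA : (Site d ((n + 1) * s)) → κ → ℝ}
      {ϑ₂ : (Site d ((n + 1) * s)) → (Site d ((n + 1) * s)) → ℝ}

/-- **ONE FULL STEP AT ORDER 2 ON THE ROAD'S TORI, ROWS** ((767) `classmap_two_step_row` with (786)'s geometry BY NAME): fine torus
`(ℤ∕(n+1)s)^d` over the coarse torus `(ℤ∕s)^d`, block map `x ↦ σ(blk n (wm x))` (fibres of EXACTLY `(n+1)^d` sites), output weight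
`e^{νρ}` (`ν ≥ 0`), next-scale weight `e^{νc ρ_s}` with `0 ≤ νc ≤ (n+1)ν` (block factor `e^{νc·dn∕(n+1)}`): the next input's letter in
the slot shape `≤ t²·(n+1)^d·e^{νc·dn∕(n+1)}·(hrϑ + dθ·αθ·dθ′·αθc∕(1−lamA))` — NO abstract geometric hypothesis left. [folklore] -/
theorem classmap_two_step_row_torus [NeZero s] {ν νc : ℝ} [Nonempty (Site d ((n + 1) * s))] [Nonempty κ]
    (hΓop : (γop • (1 : Matrix (Site d ((n + 1) * s)) (Site d ((n + 1) * s)) ℝ) - A * Aᵀ).PosSemidef) (Y : Finset (Site d ((n + 1) * s)))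
    (hUd : ∀ φ : EuclideanSpace ℝ (Site d ((n + 1) * s)), HasFDerivAt U (U' φ) φ) (hU'd : ∀ φ : EuclideanSpace ℝ (Site d ((n + 1) * s)), HasFDerivAt U' (U'' φ) φ)
    (hU''c : Continuous U'') (hκ₀ : 0 ≤ κ₀) (hκ₁ : 0 ≤ κ₁) (ha : 0 ≤ a) (hκ₂ : 0 ≤ κ₂) (hτ : 0 < τ) (hδ : 0 < δ) (hθ0 : 0 < θp) (hθ1 : θp < 1)
    (hκθ : (2 * κ₀ * (1 + τ) + 4 * δ) * γop ≤ θp) (hκθw : 2 * κ₀ * (1 + τ) * γop + 4 * δ ≤ θp)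
    (hstab : ∀ φ : EuclideanSpace ℝ (Site d ((n + 1) * s)), -(κ₀ * ∑ x ∈ Y, φ x ^ 2) ≤ U φ)
    (hU'b : ∀ φ : EuclideanSpace ℝ (Site d ((n + 1) * s)), ‖U' φ‖ ≤ κ₁ * (a + ∑ x ∈ Y, φ x ^ 2)) (hU''b : ∀ φ : EuclideanSpace ℝ (Site d ((n + 1) * s)), ‖U'' φ‖ ≤ κ₂)
    (hHk : ∀ (φ : EuclideanSpace ℝ (Site d ((n + 1) * s))) (x z : (Site d ((n + 1) * s))), |U'' φ (EuclideanSpace.single z (1 : ℝ)) (EuclideanSpace.single x (1 : ℝ))| ≤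
      Hk x z) (hHk0 : ∀ v u, 0 ≤ Hk v u) (ψ : EuclideanSpace ℝ (Site d ((n + 1) * s))) (hαr : ∀ u, ∑ w, |A u w| ≤ αr) (hαc : ∀ w, ∑ u, |A u w| ≤ αc)
    (hhr : ∀ v, ∑ u, Hk v u ≤ hr) (hlam : ∀ x : κ, ∑ u, ∑ v, |A u x| * |A v x| * Hk v u ≤ lamA) (hlam1 : lamA < 1) (hγ : αc * hr * αr / (1 - lamA) ≤ γ) (hγ1 : γ < 1)
    (hD : ∀ x y, 0 ≤ D x y)
    (hDC : ∀ x y, (if x = y then (1 : ℝ) else 0) + ∑ z, D x z * ((if y = z then 0 else ∑ u, ∑ v, |A u y| * |A v z| * Hk v u) / (1 - lamA)) ≤ D x y)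
    (hθnn : ∀ z w, 0 ≤ θ z w) (hDθr : ∀ z', ∑ w, D z' w * θ z' w ≤ dθ) (hdθ : 0 ≤ dθ) (hDθc : ∀ w, ∑ z', D z' w * θ z' w ≤ dθ') (hdθ' : 0 ≤ dθ') (hσ0 : ∀ x w, 0 ≤ σ x w)
    (hσθ : ∀ x z' w, σ x w ≤ σ x z' * θ z' w) (hϑ12 : ∀ x y, Real.exp (ν * ∑ i, (((x i - y i).valMinAbs.natAbs : ℕ) : ℝ)) ≤ ϑ₂ x y) (hϑ₂symm : ∀ x y, ϑ₂ x y = ϑ₂ y x)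
    (hϑσ : ∀ x z w, Real.exp (ν * ∑ i, (((x i - z i).valMinAbs.natAbs : ℕ) : ℝ)) ≤ σ x w * σ z w) (hσA0 : ∀ u z', 0 ≤ σA u z')
    (hσϑ₂ : ∀ v u z', σ v z' ≤ ϑ₂ v u * σA u z') (hAr : ∀ u, ∑ z', |A u z'| * σA u z' ≤ αrσ) (hαrσ : 0 ≤ αrσ) (hAc : ∀ z', ∑ u, |A u z'| * σA u z' ≤ αcσ) (hαcσ : 0 ≤ αcσ)
    (hhrw : ∀ a, ∑ b, ϑ₂ a b * Hk a b ≤ hrϑ) (hhc : ∀ a, ∑ b, ϑ₂ a b * Hk b a ≤ hcϑ) (hαθ : hrϑ * αrσ ≤ αθ) (hαθc : hcϑ * αcσ ≤ αθc)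
    (hν : 0 ≤ ν) (hνc : 0 ≤ νc) (hrate : νc ≤ ((n : ℝ) + 1) * ν) (t : ℝ) (y₁ : Site d s) :
    ∑ y₂, Real.exp (νc * ∑ i, (((y₁ i - y₂ i).valMinAbs.natAbs : ℕ) : ℝ)) *
        (t ^ 2 * ∑ x ∈ Finset.univ.filter (fun x => siteOf d s (blk n (windowMap d ((n + 1) * s) x)) = y₁), ∑ x' ∈ Finset.univ.filter
          (fun x' => siteOf d s (blk n (windowMap d ((n + 1) * s) x')) = y₂),
          |((∫ ω : EuclideanSpace ℝ (Site d ((n + 1) * s)), exp (-U (ω + ψ)) ∂(multivariateGaussian 0 (A * Aᵀ)))⁻¹ •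
            (∫ ω : EuclideanSpace ℝ (Site d ((n + 1) * s)), exp (-U (ω + ψ)) • (U'' (ω + ψ) - (U' (ω + ψ)).smulRight (U' (ω + ψ))) ∂(multivariateGaussian 0 (A * Aᵀ))) +
            (((∫ ω : EuclideanSpace ℝ (Site d ((n + 1) * s)), exp (-U (ω + ψ)) ∂(multivariateGaussian 0 (A * Aᵀ))) ^ 2)⁻¹ • ∫ ω : EuclideanSpace ℝ (Site d ((n + 1) * s)),
              exp (-U (ω + ψ)) • U' (ω + ψ) ∂(multivariateGaussian 0 (A * Aᵀ))).smulRight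
            (∫ ω : EuclideanSpace ℝ (Site d ((n + 1) * s)), exp (-U (ω + ψ)) • U' (ω + ψ) ∂(multivariateGaussian 0 (A * Aᵀ)))) (EuclideanSpace.single x' (1 : ℝ))
          (EuclideanSpace.single x (1 : ℝ))|) ≤
      t ^ 2 * (((n + 1) ^ d : ℕ) : ℝ) * Real.exp (νc * ((d : ℝ) * n / ((n : ℝ) + 1))) * (hrϑ + dθ * αθ * (dθ' * αθc) / (1 - lamA)) :=
  classmap_two_step_row (ϑ := fun x y : (Site d ((n + 1) * s)) => Real.exp (ν * ∑ i, (((x i - y i).valMinAbs.natAbs : ℕ) : ℝ))) hΓop Y hUd hU'd hU''c hκ₀ hκ₁ ha hκ₂ hτ hδ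
      hθ0 hθ1 hκθ hκθw hstab hU'b hU''b hHk hHk0 ψ hαr hαc hhr hlam hlam1 hγ hγ1 hD hDC hθnn hDθr hdθ hDθc hdθ' hσ0 hσθ
      (fun x y => torus_weight_one_le ((n + 1) * s) hν x y) hϑ12 hϑ₂symm hϑσ hσA0 hσϑ₂ hAr hαrσ hAc hαcσ hhrw hhc hαθ hαθc
    (fun x : (Site d ((n + 1) * s)) => siteOf d s (blk n (windowMap d ((n + 1) * s) x))) (fibre_card_le n s) (M := Real.exp (νc * ((d : ℝ) * n / ((n : ℝ) + 1))))
    (ϑc := fun y y' : Site d s => Real.exp (νc * ∑ i, (((y i - y' i).valMinAbs.natAbs : ℕ) : ℝ))) (Real.exp_pos _).le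
    (fun x x' => torus_block_factor n s hνc hrate x x') t y₁

/-- **ONE FULL STEP AT ORDER 2 ON THE ROAD'S TORI, COLUMNS** ((767) `classmap_two_step_col` with (786)'s geometry BY NAME): fine torus
`(ℤ∕(n+1)s)^d` over the coarse torus `(ℤ∕s)^d`, block map `x ↦ σ(blk n (wm x))` (fibres of EXACTLY `(n+1)^d` sites), output weight
`e^{νρ}` (`ν ≥ 0`), next-scale weight `e^{νc ρ_s}` with `0 ≤ νc ≤ (n+1)ν` (block factor `e^{νc·dn∕(n+1)}`): the next input's letter in
the slot shape `≤ t²·(n+1)^d·e^{νc·dn∕(n+1)}·(hcϑ + dθ·αθ·dθ′·αθc∕(1−lamA))` — NO abstract geometric hypothesis left. [folklore] -/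
theorem classmap_two_step_col_torus [NeZero s] {ν νc : ℝ} [Nonempty (Site d ((n + 1) * s))] [Nonempty κ]
    (hΓop : (γop • (1 : Matrix (Site d ((n + 1) * s)) (Site d ((n + 1) * s)) ℝ) - A * Aᵀ).PosSemidef) (Y : Finset (Site d ((n + 1) * s)))
    (hUd : ∀ φ : EuclideanSpace ℝ (Site d ((n + 1) * s)), HasFDerivAt U (U' φ) φ) (hU'd : ∀ φ : EuclideanSpace ℝ (Site d ((n + 1) * s)), HasFDerivAt U' (U'' φ) φ)
    (hU''c : Continuous U'') (hκ₀ : 0 ≤ κ₀) (hκ₁ : 0 ≤ κ₁) (ha : 0 ≤ a) (hκ₂ : 0 ≤ κ₂) (hτ : 0 < τ) (hδ : 0 < δ) (hθ0 : 0 < θp) (hθ1 : θp < 1)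
    (hκθ : (2 * κ₀ * (1 + τ) + 4 * δ) * γop ≤ θp) (hκθw : 2 * κ₀ * (1 + τ) * γop + 4 * δ ≤ θp)
    (hstab : ∀ φ : EuclideanSpace ℝ (Site d ((n + 1) * s)), -(κ₀ * ∑ x ∈ Y, φ x ^ 2) ≤ U φ)
    (hU'b : ∀ φ : EuclideanSpace ℝ (Site d ((n + 1) * s)), ‖U' φ‖ ≤ κ₁ * (a + ∑ x ∈ Y, φ x ^ 2)) (hU''b : ∀ φ : EuclideanSpace ℝ (Site d ((n + 1) * s)), ‖U'' φ‖ ≤ κ₂)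
    (hHk : ∀ (φ : EuclideanSpace ℝ (Site d ((n + 1) * s))) (x z : (Site d ((n + 1) * s))), |U'' φ (EuclideanSpace.single z (1 : ℝ)) (EuclideanSpace.single x (1 : ℝ))| ≤
      Hk x z) (hHk0 : ∀ v u, 0 ≤ Hk v u) (ψ : EuclideanSpace ℝ (Site d ((n + 1) * s))) (hαr : ∀ u, ∑ w, |A u w| ≤ αr) (hαc : ∀ w, ∑ u, |A u w| ≤ αc)
    (hhr : ∀ v, ∑ u, Hk v u ≤ hr) (hlam : ∀ x : κ, ∑ u, ∑ v, |A u x| * |A v x| * Hk v u ≤ lamA) (hlam1 : lamA < 1) (hγ : αc * hr * αr / (1 - lamA) ≤ γ) (hγ1 : γ < 1)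
    (hD : ∀ x y, 0 ≤ D x y)
    (hDC : ∀ x y, (if x = y then (1 : ℝ) else 0) + ∑ z, D x z * ((if y = z then 0 else ∑ u, ∑ v, |A u y| * |A v z| * Hk v u) / (1 - lamA)) ≤ D x y)
    (hθnn : ∀ z w, 0 ≤ θ z w) (hDθr : ∀ z', ∑ w, D z' w * θ z' w ≤ dθ) (hdθ : 0 ≤ dθ) (hDθc : ∀ w, ∑ z', D z' w * θ z' w ≤ dθ') (hdθ' : 0 ≤ dθ') (hσ0 : ∀ x w, 0 ≤ σ x w)
    (hσθ : ∀ x z' w, σ x w ≤ σ x z' * θ z' w) (hϑ12 : ∀ x y, Real.exp (ν * ∑ i, (((x i - y i).valMinAbs.natAbs : ℕ) : ℝ)) ≤ ϑ₂ x y) (hϑ₂symm : ∀ x y, ϑ₂ x y = ϑ₂ y x)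
    (hϑσ : ∀ x z w, Real.exp (ν * ∑ i, (((x i - z i).valMinAbs.natAbs : ℕ) : ℝ)) ≤ σ x w * σ z w) (hσA0 : ∀ u z', 0 ≤ σA u z')
    (hσϑ₂ : ∀ v u z', σ v z' ≤ ϑ₂ v u * σA u z') (hAr : ∀ u, ∑ z', |A u z'| * σA u z' ≤ αrσ) (hαrσ : 0 ≤ αrσ) (hAc : ∀ z', ∑ u, |A u z'| * σA u z' ≤ αcσ) (hαcσ : 0 ≤ αcσ)
    (hhrw : ∀ a, ∑ b, ϑ₂ a b * Hk a b ≤ hrϑ) (hhc : ∀ a, ∑ b, ϑ₂ a b * Hk b a ≤ hcϑ) (hαθ : hrϑ * αrσ ≤ αθ) (hαθc : hcϑ * αcσ ≤ αθc)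
    (hν : 0 ≤ ν) (hνc : 0 ≤ νc) (hrate : νc ≤ ((n : ℝ) + 1) * ν) (t : ℝ) (y₁ : Site d s) :
    ∑ y₂, Real.exp (νc * ∑ i, (((y₁ i - y₂ i).valMinAbs.natAbs : ℕ) : ℝ)) *
        (t ^ 2 * ∑ x ∈ Finset.univ.filter (fun x => siteOf d s (blk n (windowMap d ((n + 1) * s) x)) = y₂), ∑ x' ∈ Finset.univ.filter
          (fun x' => siteOf d s (blk n (windowMap d ((n + 1) * s) x')) = y₁),
          |((∫ ω : EuclideanSpace ℝ (Site d ((n + 1) * s)), exp (-U (ω + ψ)) ∂(multivariateGaussian 0 (A * Aᵀ)))⁻¹ •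
            (∫ ω : EuclideanSpace ℝ (Site d ((n + 1) * s)), exp (-U (ω + ψ)) • (U'' (ω + ψ) - (U' (ω + ψ)).smulRight (U' (ω + ψ))) ∂(multivariateGaussian 0 (A * Aᵀ))) +
            (((∫ ω : EuclideanSpace ℝ (Site d ((n + 1) * s)), exp (-U (ω + ψ)) ∂(multivariateGaussian 0 (A * Aᵀ))) ^ 2)⁻¹ • ∫ ω : EuclideanSpace ℝ (Site d ((n + 1) * s)),
              exp (-U (ω + ψ)) • U' (ω + ψ) ∂(multivariateGaussian 0 (A * Aᵀ))).smulRight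
            (∫ ω : EuclideanSpace ℝ (Site d ((n + 1) * s)), exp (-U (ω + ψ)) • U' (ω + ψ) ∂(multivariateGaussian 0 (A * Aᵀ)))) (EuclideanSpace.single x' (1 : ℝ))
          (EuclideanSpace.single x (1 : ℝ))|) ≤
      t ^ 2 * (((n + 1) ^ d : ℕ) : ℝ) * Real.exp (νc * ((d : ℝ) * n / ((n : ℝ) + 1))) * (hcϑ + dθ * αθ * (dθ' * αθc) / (1 - lamA)) :=
  classmap_two_step_col (ϑ := fun x y : (Site d ((n + 1) * s)) => Real.exp (ν * ∑ i, (((x i - y i).valMinAbs.natAbs : ℕ) : ℝ))) hΓop Y hUd hU'd hU''c hκ₀ hκ₁ ha hκ₂ hτ hδ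
      hθ0 hθ1 hκθ hκθw hstab hU'b hU''b hHk hHk0 ψ hαr hαc hhr hlam hlam1 hγ hγ1 hD hDC hθnn hDθr hdθ hDθc hdθ' hσ0 hσθ
      (fun x y => torus_weight_one_le ((n + 1) * s) hν x y) hϑ12 hϑ₂symm hϑσ hσA0 hσϑ₂ hAr hαrσ hAc hαcσ hhrw hhc hαθ hαθc
      (fun x y => torus_weight_symm ((n + 1) * s) ν x y)
    (fun x : (Site d ((n + 1) * s)) => siteOf d s (blk n (windowMap d ((n + 1) * s) x))) (fibre_card_le n s) (M := Real.exp (νc * ((d : ℝ) * n / ((n : ℝ) + 1))))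
    (ϑc := fun y y' : Site d s => Real.exp (νc * ∑ i, (((y i - y' i).valMinAbs.natAbs : ℕ) : ℝ))) (Real.exp_pos _).le
    (fun x x' => torus_block_factor n s hνc hrate x x') t y₁

/-! ## Toy -/

/-- Toy (the instance's factor in numbers): `d = 4`, `n + 1 = 2`, `t = 1∕2`, `νc = 0`: `t²·(n+1)^d·M = ¼·16·1 = 4 = (n+1)²` — order 2 is relevant. -/
example : ((1 : ℝ) / 2) ^ 2 * 16 * 1 = 4 := by norm_num

end Summit.QuantumFields.BalabanUV.T4Continuum.NE7b.SupWeightedClassMapOrderTwoStepTorus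

end
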